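/-
Copyright: the b2b-balaban T⁴-continuum CRUX team, row NE7b leaf lineage `t4-ne7b-formalise-leaf-01` (gen 81). Project licence.
-/
import Summits.QuantumFields.BalabanUV.T4Continuum.Spine.NE7b.ConvexWindowMinimiser
import Mathlib.MeasureTheory.Function.L2Space

/-!
# THE `hcrit`-FREE CENTRING LETTER, TILTED FORMS: `∫‖y − x₀‖² dν_{V,K} ≤ (2n + ‖∇V x₀‖²∕λ)∕λ`, `‖∫ y dν_{V,K} − x₀‖² ≤ …`,
# `|∫⟪u, y − x₀⟫ dν_{V,K}| ≤ ‖u‖·√((2n + ‖∇V x₀‖²∕λ)∕λ)` for the windowed tilt `ν_{V,K} = 1_K e^{−V}∕∫_K e^{−V}` about ANY `x₀ ∈ K`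
# (row NE7b, node U5c; companion of `…NE7b.ConvexWindowMinimiser`; kernel lemmas of real analysis ∕ measure theory)

Cell `pub-balaban`, sub-cell `t4`, spine estimate NE7b (`T4WeightBudget.RelWeightBound`; the cell's OWN estimate — NOT PRINTED in
[Bałaban 1983–89], NOT PROVED).  Crux-route work under `Spine/NE7b/` by a row leaf on the OWNER's windowed convexity road; NOTHING
of Bałaban's is named or asserted; no `T4Continuum/Support` leaf typed; no `def`; zero `sorry`.

WHY.  `…NE7b.ConvexWindowMinimiser` §3 proves the `hcrit`-FREE windowed second moment
`λ·∫_K ‖y − x₀‖² e^{−V} ≤ (2n + ‖∇V x₀‖²∕λ)·∫_K e^{−V}` (`K` convex bounded measurable, `x₀ ∈ K`, `V ∈ C¹` with the road's first-order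
`λ`-convexity letter ON `K`, `λ > 0` — NO variational letter at `x₀`).  The windowed convexity road consumes it through the tilted
probability measure `ν_{V,K}` (the OWNER's `…ConvexWindowVirial` §4 shapes `∫‖y‖² dν ≤ n∕λ`, `|∫⟪u,y⟫ dν| ≤ ‖u‖√(n∕λ)` and the staged
`…ConvexWindowTiltCentred` §2 shapes `‖∫ y dν‖² ≤ n∕λ`, `Σ_k q_k(∫⟪u_k,y⟫ dν)² ≤ q_max·n∕λ`, all under `hcrit` at the centre `0`).
THIS FILE gives the same four shapes about a general centre `x₀ ∈ K` and at `x₀ = 0` WITHOUT `hcrit`, the constant `n∕λ` becoming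
`(2n + ‖∇V x₀‖²∕λ)∕λ` (Young) resp., in the sharp RMS form, `√(n∕λ)` becoming `‖∇V x₀‖∕λ + √(n∕λ)` (shift + spread) — a one-name swap
for a consumer whose centre is not a critical point of `V`; the sharp form is the pricing desk's located TWO-CENTRE consumer letter
σ-ne7bref-g72-1 («`‖m‖ ≤ ‖x⋆‖ + √(n∕λ)`», PRICING-NE7b v86 F449) with the shift `‖x⋆ − x₀‖ ≤ ‖∇V x₀‖∕λ` (σ-ne7bref-g74-1 (β)) already
substituted — as a theorem it needs no argmin at all.

WHAT IS PROVED ([folklore]; Mathlib + `…ConvexWindowMinimiser` §3 + the OWNER's `…ConvexWindowVirial` BY NAME):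
`integral_norm_sub_sq_windowTilted_le_of_gradient`, `norm_sq_windowTiltedMean_sub_le_of_gradient`,
`abs_windowTiltedMean_inner_sub_le_of_gradient` (general centre `x₀ ∈ K`); `integral_norm_sq_windowTilted_le_of_gradient`,
`norm_sq_windowTiltedMean_le_of_gradient`, `abs_windowTiltedMean_inner_le_of_gradient`,
`sum_mul_sq_windowTiltedMean_le_of_orthonormal_of_gradient` (centre `0 ∈ K`; Bessel for orthonormal directions); §3 the SHARP forms
(Cauchy–Schwarz instead of Young; the root bound `λs² ≤ n + Gs ⟹ s ≤ G∕λ + √(n∕λ)` inline):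
**`sqrt_integral_norm_sub_sq_windowTilted_le_of_gradient`** (`√(∫‖y − x₀‖² dν) ≤ ‖∇V x₀‖∕λ + √(n∕λ)` — SHIFT plus SPREAD, EXACTLY the
OWNER's `√(n∕λ)` at `∇V x₀ = 0`), `norm_windowTiltedMean_sub_le_of_gradient` (`‖∫ y dν − x₀‖ ≤ …`),
`abs_windowTiltedMean_inner_sub_le_of_gradient_sharp` (`|∫⟪u, y − x₀⟫ dν| ≤ ‖u‖·(…)`), `norm_windowTiltedMean_le_of_gradient` (`x₀ = 0`).

NOT HERE (honest): the value of `‖∇V x₀‖` at print's expansion point (the pricing desk's corridor letter κ-ne7bref-g73-1, a hypothesis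
placement of the R-step statement); the identification of `K`, `V`, `λ`, `u_k`, `q_k` with Bałaban's one-step objects ((A1c)∕(A3));
anything of Bałaban's.  NE7b NOT PRINTED ∕ NOT PROVED; spine PROVED 0∕9; rung (B)+1 on a FINITE torus — NOT infinite volume, NOT the
mass gap, NOT Clay.
HONEST DEPENDENCY: continuum YM on T⁴ ⇐ BetaPertH ∧ nine spine estimates (0/9 proved); BetaPertH ⇐ (D1) ∧ (D4) ∧ CAP+tail; G-an2-4
gates asym, D1 and NE2/3/4.
-/

set_option autoImplicit false

noncomputable section

open MeasureTheory Real Set Filter Topology Metric InnerProductSpace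
open scoped RealInnerProductSpace

namespace Summit.QuantumFields.BalabanUV.T4Continuum.NE7b.ConvexWindowMinimiserTilted

open Summit.QuantumFields.BalabanUV.T4Continuum.NE7b.ConvexWindowVirial (integrableOn_of_isBounded sq_integral_le_integral_sq)
open Summit.QuantumFields.BalabanUV.T4Continuum.NE7b.ConvexWindowMinimiser (setIntegral_norm_sub_sq_mul_exp_neg_le_of_gradient)

variable {n : ℕ}

/-! ## §1 About a general centre `x₀ ∈ K` -/

/-- **THE `hcrit`-FREE WINDOWED TILTED SECOND MOMENT ABOUT `x₀`**: under the hypotheses of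
`setIntegral_norm_sub_sq_mul_exp_neg_le_of_gradient` and `volume K ≠ 0`: `∫‖y − x₀‖² dν_{V,K} ≤ (2n + ‖∇V x₀‖²∕λ)∕λ`. [folklore] -/
theorem integral_norm_sub_sq_windowTilted_le_of_gradient {V : EuclideanSpace ℝ (Fin n) → ℝ} {lam : ℝ}
    {K : Set (EuclideanSpace ℝ (Fin n))} (hlam : 0 < lam) (hK : Convex ℝ K) (hKm : MeasurableSet K)
    (hKb : Bornology.IsBounded K) (hK0 : volume K ≠ 0) {x₀ : EuclideanSpace ℝ (Fin n)} (hx₀ : x₀ ∈ K) (hV1 : ContDiff ℝ 1 V)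
    (hV : ∀ x ∈ K, ∀ y ∈ K, V x + ⟪gradient V x, y - x⟫ + lam / 2 * ‖y - x‖ ^ 2 ≤ V y) :
    ∫ y, ‖y - x₀‖ ^ 2 ∂((volume.restrict K).tilted fun x => -V x) ≤ (2 * n + ‖gradient V x₀‖ ^ 2 / lam) / lam := by
  haveI : NeZero (volume.restrict K : Measure (EuclideanSpace ℝ (Fin n))) :=
    ⟨fun h => hK0 (Measure.restrict_eq_zero.1 h)⟩
  have hZ : IntegrableOn (fun x => exp (-V x)) K := integrableOn_of_isBounded hKb hV1.continuous.neg.rexp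
  have hZpos : 0 < ∫ x in K, exp (-V x) := integral_exp_pos hZ
  have T : ∫ y, ‖y - x₀‖ ^ 2 ∂((volume.restrict K).tilted fun x => -V x) =
      (∫ y in K, ‖y - x₀‖ ^ 2 * exp (-V y)) / ∫ x in K, exp (-V x) := by
    rw [integral_tilted, ← integral_div]
    congr 1; ext y; rw [smul_eq_mul]; ring
  rw [T, div_le_div_iff₀ hZpos hlam]
  have h := setIntegral_norm_sub_sq_mul_exp_neg_le_of_gradient hlam hK hKm hKb hx₀ hV1 hV
  linarith

/-- **THE WINDOWED TILTED MEAN IS NEAR ANY `x₀ ∈ K`**: under the same hypotheses, `‖∫ y dν_{V,K} − x₀‖² ≤ (2n + ‖∇V x₀‖²∕λ)∕λ`.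
[folklore] -/
theorem norm_sq_windowTiltedMean_sub_le_of_gradient {V : EuclideanSpace ℝ (Fin n) → ℝ} {lam : ℝ}
    {K : Set (EuclideanSpace ℝ (Fin n))} (hlam : 0 < lam) (hK : Convex ℝ K) (hKm : MeasurableSet K)
    (hKb : Bornology.IsBounded K) (hK0 : volume K ≠ 0) {x₀ : EuclideanSpace ℝ (Fin n)} (hx₀ : x₀ ∈ K) (hV1 : ContDiff ℝ 1 V)
    (hV : ∀ x ∈ K, ∀ y ∈ K, V x + ⟪gradient V x, y - x⟫ + lam / 2 * ‖y - x‖ ^ 2 ≤ V y) :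
    ‖(∫ y, y ∂((volume.restrict K).tilted fun x => -V x)) - x₀‖ ^ 2 ≤ (2 * n + ‖gradient V x₀‖ ^ 2 / lam) / lam := by
  haveI : NeZero (volume.restrict K : Measure (EuclideanSpace ℝ (Fin n))) :=
    ⟨fun h => hK0 (Measure.restrict_eq_zero.1 h)⟩
  have hZ : IntegrableOn (fun x => exp (-V x)) K := integrableOn_of_isBounded hKb hV1.continuous.neg.rexp
  set ν : Measure (EuclideanSpace ℝ (Fin n)) := (volume.restrict K).tilted fun x => -V x with hν
  haveI : IsProbabilityMeasure ν := isProbabilityMeasure_tilted hZ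
  have hint : ∀ f : EuclideanSpace ℝ (Fin n) → ℝ, Continuous f → Integrable f ν := fun f hf => by
    rw [hν, integrable_tilted_iff hZ f]
    have h : Integrable (fun x => exp (-V x) * f x) (volume.restrict K) :=
      integrableOn_of_isBounded hKb (hV1.continuous.neg.rexp.mul hf)
    simpa only [smul_eq_mul] using h
  have hid' : Integrable (fun y : EuclideanSpace ℝ (Fin n) => y) ν := by
    rw [hν, integrable_tilted_iff hZ]
    exact ((hV1.continuous.neg.rexp.smul continuous_id).continuousOn.integrableOn_compact
      hKb.isCompact_closure).mono_set subset_closure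
  have hid : Integrable (fun y : EuclideanSpace ℝ (Fin n) => y - x₀) ν := hid'.sub (integrable_const x₀)
  have hm : (∫ y, y ∂ν) - x₀ = ∫ y, (y - x₀) ∂ν := by
    rw [integral_sub hid' (integrable_const x₀), integral_const, probReal_univ, one_smul]
  have h1 : Integrable (fun y : EuclideanSpace ℝ (Fin n) => ‖y - x₀‖) ν := hint _ (continuous_id.sub continuous_const).norm
  have h2 : Integrable (fun y : EuclideanSpace ℝ (Fin n) => ‖y - x₀‖ ^ 2) ν :=
    hint _ ((continuous_id.sub continuous_const).norm.pow 2)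
  rw [hm]
  calc ‖∫ y, (y - x₀) ∂ν‖ ^ 2 ≤ (∫ y, ‖y - x₀‖ ∂ν) ^ 2 :=
        pow_le_pow_left₀ (norm_nonneg _) (norm_integral_le_integral_norm _) 2
    _ ≤ ∫ y, ‖y - x₀‖ ^ 2 ∂ν := sq_integral_le_integral_sq ν h1 h2
    _ ≤ (2 * n + ‖gradient V x₀‖ ^ 2 / lam) / lam :=
        integral_norm_sub_sq_windowTilted_le_of_gradient hlam hK hKm hKb hK0 hx₀ hV1 hV

/-- **THE `hcrit`-FREE CENTRING LETTER**: under the same hypotheses, for every `u`: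
`|∫⟪u, y − x₀⟫ dν_{V,K}| ≤ ‖u‖·√((2n + ‖∇V x₀‖²∕λ)∕λ)`. [folklore] -/
theorem abs_windowTiltedMean_inner_sub_le_of_gradient {V : EuclideanSpace ℝ (Fin n) → ℝ} {lam : ℝ}
    {K : Set (EuclideanSpace ℝ (Fin n))} (hlam : 0 < lam) (hK : Convex ℝ K) (hKm : MeasurableSet K)
    (hKb : Bornology.IsBounded K) (hK0 : volume K ≠ 0) {x₀ : EuclideanSpace ℝ (Fin n)} (hx₀ : x₀ ∈ K) (hV1 : ContDiff ℝ 1 V)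
    (hV : ∀ x ∈ K, ∀ y ∈ K, V x + ⟪gradient V x, y - x⟫ + lam / 2 * ‖y - x‖ ^ 2 ≤ V y) (u : EuclideanSpace ℝ (Fin n)) :
    |∫ y, ⟪u, y - x₀⟫ ∂((volume.restrict K).tilted fun x => -V x)| ≤
      ‖u‖ * Real.sqrt ((2 * n + ‖gradient V x₀‖ ^ 2 / lam) / lam) := by
  haveI : NeZero (volume.restrict K : Measure (EuclideanSpace ℝ (Fin n))) :=
    ⟨fun h => hK0 (Measure.restrict_eq_zero.1 h)⟩
  have hZ : IntegrableOn (fun x => exp (-V x)) K := integrableOn_of_isBounded hKb hV1.continuous.neg.rexp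
  set ν : Measure (EuclideanSpace ℝ (Fin n)) := (volume.restrict K).tilted fun x => -V x with hν
  haveI : IsProbabilityMeasure ν := isProbabilityMeasure_tilted hZ
  have hint : ∀ f : EuclideanSpace ℝ (Fin n) → ℝ, Continuous f → Integrable f ν := fun f hf => by
    rw [hν, integrable_tilted_iff hZ f]
    have h : Integrable (fun x => exp (-V x) * f x) (volume.restrict K) :=
      integrableOn_of_isBounded hKb (hV1.continuous.neg.rexp.mul hf)
    simpa only [smul_eq_mul] using h
  have hc : Continuous fun y : EuclideanSpace ℝ (Fin n) => ⟪u, y - x₀⟫ := continuous_const.inner (continuous_id.sub continuous_const)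
  have hi1 : Integrable (fun y : EuclideanSpace ℝ (Fin n) => ⟪u, y - x₀⟫) ν := hint _ hc
  have hi2 : Integrable (fun y : EuclideanSpace ℝ (Fin n) => ⟪u, y - x₀⟫ ^ 2) ν := hint _ (hc.pow 2)
  have hi3 : Integrable (fun y : EuclideanSpace ℝ (Fin n) => ‖y - x₀‖ ^ 2) ν :=
    hint _ ((continuous_id.sub continuous_const).norm.pow 2)
  have hA := sq_integral_le_integral_sq ν hi1 hi2
  have hB : ∫ y, ⟪u, y - x₀⟫ ^ 2 ∂ν ≤ ‖u‖ ^ 2 * ∫ y, ‖y - x₀‖ ^ 2 ∂ν := by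
    rw [← integral_const_mul]
    refine integral_mono hi2 (hi3.const_mul _) fun y => ?_
    have h := pow_le_pow_left₀ (abs_nonneg _) (abs_real_inner_le_norm u (y - x₀)) 2
    rw [sq_abs, mul_pow] at h
    exact h
  have hC := integral_norm_sub_sq_windowTilted_le_of_gradient hlam hK hKm hKb hK0 hx₀ hV1 hV
  have hB0 : 0 ≤ (2 * n + ‖gradient V x₀‖ ^ 2 / lam) / lam :=
    div_nonneg (add_nonneg (by positivity) (div_nonneg (sq_nonneg _) hlam.le)) hlam.le
  have hsq : (∫ y, ⟪u, y - x₀⟫ ∂ν) ^ 2 ≤ (‖u‖ * Real.sqrt ((2 * n + ‖gradient V x₀‖ ^ 2 / lam) / lam)) ^ 2 := by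
    rw [mul_pow, Real.sq_sqrt hB0]
    exact hA.trans (hB.trans (mul_le_mul_of_nonneg_left hC (sq_nonneg _)))
  exact abs_le_of_sq_le_sq hsq (mul_nonneg (norm_nonneg _) (Real.sqrt_nonneg _))

/-! ## §2 At the centre `x₀ = 0`: the OWNER's shapes with `hcrit` replaced by `‖∇V 0‖` -/

/-- `∫‖y‖² dν_{V,K} ≤ (2n + ‖∇V 0‖²∕λ)∕λ` — the OWNER's `integral_norm_sq_windowTilted_le` WITHOUT `hcrit` (`0 ∈ K`). [folklore] -/
theorem integral_norm_sq_windowTilted_le_of_gradient {V : EuclideanSpace ℝ (Fin n) → ℝ} {lam : ℝ}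
    {K : Set (EuclideanSpace ℝ (Fin n))} (hlam : 0 < lam) (hK : Convex ℝ K) (hKm : MeasurableSet K)
    (hKb : Bornology.IsBounded K) (hK0 : volume K ≠ 0) (h0 : (0 : EuclideanSpace ℝ (Fin n)) ∈ K) (hV1 : ContDiff ℝ 1 V)
    (hV : ∀ x ∈ K, ∀ y ∈ K, V x + ⟪gradient V x, y - x⟫ + lam / 2 * ‖y - x‖ ^ 2 ≤ V y) :
    ∫ y, ‖y‖ ^ 2 ∂((volume.restrict K).tilted fun x => -V x) ≤ (2 * n + ‖gradient V 0‖ ^ 2 / lam) / lam := by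
  have h := integral_norm_sub_sq_windowTilted_le_of_gradient hlam hK hKm hKb hK0 h0 hV1 hV
  simpa only [sub_zero] using h

/-- `‖∫ y dν_{V,K}‖² ≤ (2n + ‖∇V 0‖²∕λ)∕λ` — the windowed mean vector is short, WITHOUT `hcrit` (`0 ∈ K`). [folklore] -/
theorem norm_sq_windowTiltedMean_le_of_gradient {V : EuclideanSpace ℝ (Fin n) → ℝ} {lam : ℝ}
    {K : Set (EuclideanSpace ℝ (Fin n))} (hlam : 0 < lam) (hK : Convex ℝ K) (hKm : MeasurableSet K)
    (hKb : Bornology.IsBounded K) (hK0 : volume K ≠ 0) (h0 : (0 : EuclideanSpace ℝ (Fin n)) ∈ K) (hV1 : ContDiff ℝ 1 V)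
    (hV : ∀ x ∈ K, ∀ y ∈ K, V x + ⟪gradient V x, y - x⟫ + lam / 2 * ‖y - x‖ ^ 2 ≤ V y) :
    ‖∫ y, y ∂((volume.restrict K).tilted fun x => -V x)‖ ^ 2 ≤ (2 * n + ‖gradient V 0‖ ^ 2 / lam) / lam := by
  have h := norm_sq_windowTiltedMean_sub_le_of_gradient hlam hK hKm hKb hK0 h0 hV1 hV
  simpa only [sub_zero] using h

/-- `|∫⟪u, y⟫ dν_{V,K}| ≤ ‖u‖·√((2n + ‖∇V 0‖²∕λ)∕λ)` — the OWNER's `abs_windowTiltedMean_inner_le` WITHOUT `hcrit` (`0 ∈ K`). [folklore] -/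
theorem abs_windowTiltedMean_inner_le_of_gradient {V : EuclideanSpace ℝ (Fin n) → ℝ} {lam : ℝ}
    {K : Set (EuclideanSpace ℝ (Fin n))} (hlam : 0 < lam) (hK : Convex ℝ K) (hKm : MeasurableSet K)
    (hKb : Bornology.IsBounded K) (hK0 : volume K ≠ 0) (h0 : (0 : EuclideanSpace ℝ (Fin n)) ∈ K) (hV1 : ContDiff ℝ 1 V)
    (hV : ∀ x ∈ K, ∀ y ∈ K, V x + ⟪gradient V x, y - x⟫ + lam / 2 * ‖y - x‖ ^ 2 ≤ V y) (u : EuclideanSpace ℝ (Fin n)) :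
    |∫ y, ⟪u, y⟫ ∂((volume.restrict K).tilted fun x => -V x)| ≤ ‖u‖ * Real.sqrt ((2 * n + ‖gradient V 0‖ ^ 2 / lam) / lam) := by
  have h := abs_windowTiltedMean_inner_sub_le_of_gradient hlam hK hKm hKb hK0 h0 hV1 hV u
  simpa only [sub_zero] using h

/-- **BESSEL ON THE WINDOWED TILTED MEANS, WITHOUT `hcrit`**: for ORTHONORMAL `u_k` and weights `q_k ≤ q_max` with `q_max ≥ 0`, `0 ∈ K`:
`Σ_k q_k·(∫⟪u_k, y⟫ dν_{V,K})² ≤ q_max·(2n + ‖∇V 0‖²∕λ)∕λ` (the staged `sum_mul_sq_windowTiltedMean_le_of_orthonormal`'s shape with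
`‖∇V 0‖` in place of the variational letter). [folklore] -/
theorem sum_mul_sq_windowTiltedMean_le_of_orthonormal_of_gradient {V : EuclideanSpace ℝ (Fin n) → ℝ} {lam qm : ℝ} {r : ℕ}
    {K : Set (EuclideanSpace ℝ (Fin n))} (hlam : 0 < lam) (hK : Convex ℝ K) (hKm : MeasurableSet K)
    (hKb : Bornology.IsBounded K) (hK0 : volume K ≠ 0) (h0 : (0 : EuclideanSpace ℝ (Fin n)) ∈ K) (hV1 : ContDiff ℝ 1 V)
    (hV : ∀ x ∈ K, ∀ y ∈ K, V x + ⟪gradient V x, y - x⟫ + lam / 2 * ‖y - x‖ ^ 2 ≤ V y)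
    (q : Fin r → ℝ) (hqm0 : 0 ≤ qm) (hqm : ∀ k, q k ≤ qm) (u : Fin r → EuclideanSpace ℝ (Fin n)) (hu : Orthonormal ℝ u) :
    ∑ k, q k * (∫ y, ⟪u k, y⟫ ∂((volume.restrict K).tilted fun x => -V x)) ^ 2 ≤
      qm * ((2 * n + ‖gradient V 0‖ ^ 2 / lam) / lam) := by
  haveI : NeZero (volume.restrict K : Measure (EuclideanSpace ℝ (Fin n))) :=
    ⟨fun h => hK0 (Measure.restrict_eq_zero.1 h)⟩
  have hZ : IntegrableOn (fun x => exp (-V x)) K := integrableOn_of_isBounded hKb hV1.continuous.neg.rexp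
  set ν : Measure (EuclideanSpace ℝ (Fin n)) := (volume.restrict K).tilted fun x => -V x with hν
  haveI : IsProbabilityMeasure ν := isProbabilityMeasure_tilted hZ
  have h1 : Integrable (fun y : EuclideanSpace ℝ (Fin n) => y) ν := by
    rw [hν, integrable_tilted_iff hZ]
    exact ((hV1.continuous.neg.rexp.smul continuous_id).continuousOn.integrableOn_compact hKb.isCompact_closure).mono_set
      subset_closure
  set m : EuclideanSpace ℝ (Fin n) := ∫ y, y ∂ν with hm
  -- `∫⟪u_k, y⟫ dν = ⟪u_k, m⟫` (the inner product with a fixed vector commutes with the Bochner integral)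
  have hmk : ∀ k, ∫ y, ⟪u k, y⟫ ∂ν = ⟪u k, m⟫ := fun k => integral_inner h1 (u k)
  simp_rw [hmk]
  have hB : ∑ k, ⟪u k, m⟫ ^ 2 ≤ ‖m‖ ^ 2 := by
    have := hu.sum_inner_products_le (s := Finset.univ) (x := m)
    simpa only [Real.norm_eq_abs, sq_abs] using this
  have hM : ‖m‖ ^ 2 ≤ (2 * n + ‖gradient V 0‖ ^ 2 / lam) / lam :=
    norm_sq_windowTiltedMean_le_of_gradient hlam hK hKm hKb hK0 h0 hV1 hV
  calc ∑ k, q k * ⟪u k, m⟫ ^ 2 ≤ ∑ k, qm * ⟪u k, m⟫ ^ 2 :=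
        Finset.sum_le_sum fun k _ => mul_le_mul_of_nonneg_right (hqm k) (sq_nonneg _)
    _ = qm * ∑ k, ⟪u k, m⟫ ^ 2 := by rw [Finset.mul_sum]
    _ ≤ qm * ‖m‖ ^ 2 := mul_le_mul_of_nonneg_left hB hqm0
    _ ≤ qm * ((2 * n + ‖gradient V 0‖ ^ 2 / lam) / lam) := mul_le_mul_of_nonneg_left hM hqm0

/-! ## §3 The SHARP form (Cauchy–Schwarz instead of Young): RMS distance from `x₀` ≤ SHIFT `‖∇V x₀‖∕λ` + SPREAD `√(n∕λ)` -/

/-- **THE SHARP `hcrit`-FREE CENTRING LETTER (RMS form)**: `K` convex, bounded, measurable, of positive volume, `x₀ ∈ K`; `V ∈ C¹`,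
`λ`-uniformly convex ON `K`, `λ > 0`; NO variational letter at `x₀`:
`√(∫‖y − x₀‖² dν_{V,K}) ≤ ‖∇V x₀‖∕λ + √(n∕λ)` — SHIFT plus SPREAD; at `∇V x₀ = 0` EXACTLY the OWNER's `√(n∕λ)`
(the Cauchy–Schwarz form of `…ConvexWindowMinimiser` divided by `∫_K e^{−V}`, Jensen `∫‖y − x₀‖dν ≤ √(∫‖y − x₀‖² dν)`, and the root bound).
[folklore] -/
theorem sqrt_integral_norm_sub_sq_windowTilted_le_of_gradient {V : EuclideanSpace ℝ (Fin n) → ℝ} {lam : ℝ}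
    {K : Set (EuclideanSpace ℝ (Fin n))} (hlam : 0 < lam) (hK : Convex ℝ K) (hKm : MeasurableSet K)
    (hKb : Bornology.IsBounded K) (hK0 : volume K ≠ 0) {x₀ : EuclideanSpace ℝ (Fin n)} (hx₀ : x₀ ∈ K) (hV1 : ContDiff ℝ 1 V)
    (hV : ∀ x ∈ K, ∀ y ∈ K, V x + ⟪gradient V x, y - x⟫ + lam / 2 * ‖y - x‖ ^ 2 ≤ V y) :
    Real.sqrt (∫ y, ‖y - x₀‖ ^ 2 ∂((volume.restrict K).tilted fun x => -V x)) ≤ ‖gradient V x₀‖ / lam + Real.sqrt (n / lam) := by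
  haveI : NeZero (volume.restrict K : Measure (EuclideanSpace ℝ (Fin n))) :=
    ⟨fun h => hK0 (Measure.restrict_eq_zero.1 h)⟩
  have hZ : IntegrableOn (fun x => exp (-V x)) K := integrableOn_of_isBounded hKb hV1.continuous.neg.rexp
  have hZpos : 0 < ∫ x in K, exp (-V x) := integral_exp_pos hZ
  set ν : Measure (EuclideanSpace ℝ (Fin n)) := (volume.restrict K).tilted fun x => -V x with hν
  haveI : IsProbabilityMeasure ν := isProbabilityMeasure_tilted hZ
  have hint : ∀ f : EuclideanSpace ℝ (Fin n) → ℝ, Continuous f → Integrable f ν := fun f hf => by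
    rw [hν, integrable_tilted_iff hZ f]
    have h : Integrable (fun x => exp (-V x) * f x) (volume.restrict K) :=
      integrableOn_of_isBounded hKb (hV1.continuous.neg.rexp.mul hf)
    simpa only [smul_eq_mul] using h
  have hfc : Continuous fun y : EuclideanSpace ℝ (Fin n) => ‖y - x₀‖ := (continuous_id.sub continuous_const).norm
  have h1 : Integrable (fun y : EuclideanSpace ℝ (Fin n) => ‖y - x₀‖) ν := hint _ hfc
  have h2 : Integrable (fun y : EuclideanSpace ℝ (Fin n) => ‖y - x₀‖ ^ 2) ν := hint _ (hfc.pow 2)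
  -- the tilted integrals as quotients
  have T : ∀ f : EuclideanSpace ℝ (Fin n) → ℝ, ∫ y, f y ∂ν = (∫ y in K, f y * exp (-V y)) / ∫ x in K, exp (-V x) := fun f => by
    rw [hν, integral_tilted, ← integral_div]
    congr 1; ext y; rw [smul_eq_mul]; ring
  set G : ℝ := ‖gradient V x₀‖ with hG
  have hG0 : 0 ≤ G := norm_nonneg _
  -- `λ·∫‖y − x₀‖² dν ≤ n + G·∫‖y − x₀‖ dν`
  have hraw := ConvexWindowMinimiser.setIntegral_norm_sub_sq_mul_exp_neg_le_add hK hKm hKb hx₀ hV1 hV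
  have hν2 : lam * ∫ y, ‖y - x₀‖ ^ 2 ∂ν ≤ n + G * ∫ y, ‖y - x₀‖ ∂ν := by
    rw [T, T]
    have e1 : lam * ((∫ y in K, ‖y - x₀‖ ^ 2 * exp (-V y)) / ∫ x in K, exp (-V x)) =
        (lam * ∫ y in K, ‖y - x₀‖ ^ 2 * exp (-V y)) / ∫ x in K, exp (-V x) := by ring
    have e2 : (n : ℝ) + G * ((∫ y in K, ‖y - x₀‖ * exp (-V y)) / ∫ x in K, exp (-V x)) =
        ((n : ℝ) * (∫ x in K, exp (-V x)) + G * ∫ y in K, ‖y - x₀‖ * exp (-V y)) / ∫ x in K, exp (-V x) := by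
      field_simp
    rw [e1, e2]
    exact div_le_div_of_nonneg_right hraw hZpos.le
  -- Jensen and the root bound
  have hJ : (∫ y, ‖y - x₀‖ ∂ν) ^ 2 ≤ ∫ y, ‖y - x₀‖ ^ 2 ∂ν := sq_integral_le_integral_sq ν h1 h2
  have hM1 : ∫ y, ‖y - x₀‖ ∂ν ≤ Real.sqrt (∫ y, ‖y - x₀‖ ^ 2 ∂ν) := (le_abs_self _).trans (Real.abs_le_sqrt hJ)
  have hs2 : Real.sqrt (∫ y, ‖y - x₀‖ ^ 2 ∂ν) ^ 2 = ∫ y, ‖y - x₀‖ ^ 2 ∂ν :=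
    Real.sq_sqrt (integral_nonneg fun _ => sq_nonneg _)
  have key : lam * Real.sqrt (∫ y, ‖y - x₀‖ ^ 2 ∂ν) ^ 2 ≤ n + G * Real.sqrt (∫ y, ‖y - x₀‖ ^ 2 ∂ν) := by
    rw [hs2]
    exact hν2.trans (by nlinarith [mul_le_mul_of_nonneg_left hM1 hG0])
  -- the positive root of `λ s² ≤ n + G s`: `s ≤ G∕λ + √(n∕λ)` (inline; the same [folklore] step as the tree's
  -- `Literature.Analysis.PDE.NeumannHalfBallRegularity.le_of_sq_le_affine`, not imported to keep the row's dependency cone inside `Spine/NE7b`)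
  set s : ℝ := Real.sqrt (∫ y, ‖y - x₀‖ ^ 2 ∂ν) with hs
  set t : ℝ := Real.sqrt (n / lam) with ht
  have ht0 : 0 ≤ t := Real.sqrt_nonneg _
  have hl : lam ≠ 0 := hlam.ne'
  have ht2 : lam * t ^ 2 = n := by
    rw [ht, Real.sq_sqrt (div_nonneg (Nat.cast_nonneg n) hlam.le)]
    field_simp
  by_contra hcon
  rw [not_le] at hcon
  have hspos : 0 < s := lt_of_le_of_lt (by positivity) hcon
  have h1 : G + lam * t < lam * s := by
    have e : lam * (G / lam + t) = G + lam * t := by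
      field_simp
    have := mul_lt_mul_of_pos_left hcon hlam
    rwa [e] at this
  have h2 : (G + lam * t) * s < lam * s * s := mul_lt_mul_of_pos_right h1 hspos
  have h3 : lam * t * (G / lam + t) ≤ lam * t * s := mul_le_mul_of_nonneg_left hcon.le (by positivity)
  have h4 : lam * t * (G / lam + t) = G * t + lam * t ^ 2 := by
    field_simp
  have h5 : lam * s ^ 2 = lam * s * s := by ring
  nlinarith [mul_nonneg hG0 ht0]

/-- **THE WINDOWED TILTED MEAN, SHARP FORM**: under the same hypotheses, `‖∫ y dν_{V,K} − x₀‖ ≤ ‖∇V x₀‖∕λ + √(n∕λ)`. [folklore] -/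
theorem norm_windowTiltedMean_sub_le_of_gradient {V : EuclideanSpace ℝ (Fin n) → ℝ} {lam : ℝ}
    {K : Set (EuclideanSpace ℝ (Fin n))} (hlam : 0 < lam) (hK : Convex ℝ K) (hKm : MeasurableSet K)
    (hKb : Bornology.IsBounded K) (hK0 : volume K ≠ 0) {x₀ : EuclideanSpace ℝ (Fin n)} (hx₀ : x₀ ∈ K) (hV1 : ContDiff ℝ 1 V)
    (hV : ∀ x ∈ K, ∀ y ∈ K, V x + ⟪gradient V x, y - x⟫ + lam / 2 * ‖y - x‖ ^ 2 ≤ V y) :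
    ‖(∫ y, y ∂((volume.restrict K).tilted fun x => -V x)) - x₀‖ ≤ ‖gradient V x₀‖ / lam + Real.sqrt (n / lam) := by
  haveI : NeZero (volume.restrict K : Measure (EuclideanSpace ℝ (Fin n))) :=
    ⟨fun h => hK0 (Measure.restrict_eq_zero.1 h)⟩
  have hZ : IntegrableOn (fun x => exp (-V x)) K := integrableOn_of_isBounded hKb hV1.continuous.neg.rexp
  set ν : Measure (EuclideanSpace ℝ (Fin n)) := (volume.restrict K).tilted fun x => -V x with hν
  haveI : IsProbabilityMeasure ν := isProbabilityMeasure_tilted hZ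
  have hint : ∀ f : EuclideanSpace ℝ (Fin n) → ℝ, Continuous f → Integrable f ν := fun f hf => by
    rw [hν, integrable_tilted_iff hZ f]
    have h : Integrable (fun x => exp (-V x) * f x) (volume.restrict K) :=
      integrableOn_of_isBounded hKb (hV1.continuous.neg.rexp.mul hf)
    simpa only [smul_eq_mul] using h
  have hid' : Integrable (fun y : EuclideanSpace ℝ (Fin n) => y) ν := by
    rw [hν, integrable_tilted_iff hZ]
    exact ((hV1.continuous.neg.rexp.smul continuous_id).continuousOn.integrableOn_compact
      hKb.isCompact_closure).mono_set subset_closure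
  have hm : (∫ y, y ∂ν) - x₀ = ∫ y, (y - x₀) ∂ν := by
    rw [integral_sub hid' (integrable_const x₀), integral_const, probReal_univ, one_smul]
  have h1 : Integrable (fun y : EuclideanSpace ℝ (Fin n) => ‖y - x₀‖) ν := hint _ (continuous_id.sub continuous_const).norm
  have h2 : Integrable (fun y : EuclideanSpace ℝ (Fin n) => ‖y - x₀‖ ^ 2) ν :=
    hint _ ((continuous_id.sub continuous_const).norm.pow 2)
  have hJ : (∫ y, ‖y - x₀‖ ∂ν) ^ 2 ≤ ∫ y, ‖y - x₀‖ ^ 2 ∂ν := sq_integral_le_integral_sq ν h1 h2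
  rw [hm]
  calc ‖∫ y, (y - x₀) ∂ν‖ ≤ ∫ y, ‖y - x₀‖ ∂ν := norm_integral_le_integral_norm _
    _ ≤ Real.sqrt (∫ y, ‖y - x₀‖ ^ 2 ∂ν) := (le_abs_self _).trans (Real.abs_le_sqrt hJ)
    _ ≤ ‖gradient V x₀‖ / lam + Real.sqrt (n / lam) :=
        sqrt_integral_norm_sub_sq_windowTilted_le_of_gradient hlam hK hKm hKb hK0 hx₀ hV1 hV

/-- **THE `hcrit`-FREE CENTRING LETTER, SHARP FORM**: under the same hypotheses, for every `u`:
`|∫⟪u, y − x₀⟫ dν_{V,K}| ≤ ‖u‖·(‖∇V x₀‖∕λ + √(n∕λ))` — at `∇V x₀ = 0` EXACTLY the OWNER's `abs_windowTiltedMean_inner_le`. [folklore] -/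
theorem abs_windowTiltedMean_inner_sub_le_of_gradient_sharp {V : EuclideanSpace ℝ (Fin n) → ℝ} {lam : ℝ}
    {K : Set (EuclideanSpace ℝ (Fin n))} (hlam : 0 < lam) (hK : Convex ℝ K) (hKm : MeasurableSet K)
    (hKb : Bornology.IsBounded K) (hK0 : volume K ≠ 0) {x₀ : EuclideanSpace ℝ (Fin n)} (hx₀ : x₀ ∈ K) (hV1 : ContDiff ℝ 1 V)
    (hV : ∀ x ∈ K, ∀ y ∈ K, V x + ⟪gradient V x, y - x⟫ + lam / 2 * ‖y - x‖ ^ 2 ≤ V y) (u : EuclideanSpace ℝ (Fin n)) :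
    |∫ y, ⟪u, y - x₀⟫ ∂((volume.restrict K).tilted fun x => -V x)| ≤ ‖u‖ * (‖gradient V x₀‖ / lam + Real.sqrt (n / lam)) := by
  haveI : NeZero (volume.restrict K : Measure (EuclideanSpace ℝ (Fin n))) :=
    ⟨fun h => hK0 (Measure.restrict_eq_zero.1 h)⟩
  have hZ : IntegrableOn (fun x => exp (-V x)) K := integrableOn_of_isBounded hKb hV1.continuous.neg.rexp
  set ν : Measure (EuclideanSpace ℝ (Fin n)) := (volume.restrict K).tilted fun x => -V x with hν
  haveI : IsProbabilityMeasure ν := isProbabilityMeasure_tilted hZ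
  have hint : ∀ f : EuclideanSpace ℝ (Fin n) → ℝ, Continuous f → Integrable f ν := fun f hf => by
    rw [hν, integrable_tilted_iff hZ f]
    have h : Integrable (fun x => exp (-V x) * f x) (volume.restrict K) :=
      integrableOn_of_isBounded hKb (hV1.continuous.neg.rexp.mul hf)
    simpa only [smul_eq_mul] using h
  have hfc : Continuous fun y : EuclideanSpace ℝ (Fin n) => ‖y - x₀‖ := (continuous_id.sub continuous_const).norm
  have h1 : Integrable (fun y : EuclideanSpace ℝ (Fin n) => ‖y - x₀‖) ν := hint _ hfc
  have h2 : Integrable (fun y : EuclideanSpace ℝ (Fin n) => ‖y - x₀‖ ^ 2) ν := hint _ (hfc.pow 2)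
  have hi : Integrable (fun y : EuclideanSpace ℝ (Fin n) => |⟪u, y - x₀⟫|) ν :=
    (hint _ (continuous_const.inner (continuous_id.sub continuous_const))).abs
  have hJ : (∫ y, ‖y - x₀‖ ∂ν) ^ 2 ≤ ∫ y, ‖y - x₀‖ ^ 2 ∂ν := sq_integral_le_integral_sq ν h1 h2
  calc |∫ y, ⟪u, y - x₀⟫ ∂ν| ≤ ∫ y, |⟪u, y - x₀⟫| ∂ν := abs_integral_le_integral_abs
    _ ≤ ∫ y, ‖u‖ * ‖y - x₀‖ ∂ν := integral_mono hi (h1.const_mul _) fun y => abs_real_inner_le_norm u (y - x₀)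
    _ = ‖u‖ * ∫ y, ‖y - x₀‖ ∂ν := integral_const_mul _ _
    _ ≤ ‖u‖ * Real.sqrt (∫ y, ‖y - x₀‖ ^ 2 ∂ν) :=
        mul_le_mul_of_nonneg_left ((le_abs_self _).trans (Real.abs_le_sqrt hJ)) (norm_nonneg _)
    _ ≤ ‖u‖ * (‖gradient V x₀‖ / lam + Real.sqrt (n / lam)) := mul_le_mul_of_nonneg_left
        (sqrt_integral_norm_sub_sq_windowTilted_le_of_gradient hlam hK hKm hKb hK0 hx₀ hV1 hV) (norm_nonneg _)

/-- At `x₀ = 0 ∈ K`: `‖∫ y dν_{V,K}‖ ≤ ‖∇V 0‖∕λ + √(n∕λ)` — the windowed mean vector is short, sharp form, WITHOUT `hcrit`. [folklore] -/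
theorem norm_windowTiltedMean_le_of_gradient {V : EuclideanSpace ℝ (Fin n) → ℝ} {lam : ℝ}
    {K : Set (EuclideanSpace ℝ (Fin n))} (hlam : 0 < lam) (hK : Convex ℝ K) (hKm : MeasurableSet K)
    (hKb : Bornology.IsBounded K) (hK0 : volume K ≠ 0) (h0 : (0 : EuclideanSpace ℝ (Fin n)) ∈ K) (hV1 : ContDiff ℝ 1 V)
    (hV : ∀ x ∈ K, ∀ y ∈ K, V x + ⟪gradient V x, y - x⟫ + lam / 2 * ‖y - x‖ ^ 2 ≤ V y) :
    ‖∫ y, y ∂((volume.restrict K).tilted fun x => -V x)‖ ≤ ‖gradient V 0‖ / lam + Real.sqrt (n / lam) := by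
  have h := norm_windowTiltedMean_sub_le_of_gradient hlam hK hKm hKb hK0 h0 hV1 hV
  simpa only [sub_zero] using h

end Summit.QuantumFields.BalabanUV.T4Continuum.NE7b.ConvexWindowMinimiserTilted

end
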